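import Literature.Probability.Percolation.MeanClusterSizeExponentFromFacts
import Literature.Probability.Percolation.KestenScalingFromFourFacts
import Literature.Probability.Percolation.NearCriticalOneArmFromFourFacts
import Literature.Probability.Percolation.HalfPlaneTwoArmRadiiNearCritical
import HarnessLib

/-!
# `χ(p) = |p - 1/2|^{-43/18 + o(1)}` from the two arm exponents and the standard near-critical facts (assembly, proofs only)

Topic `Literature/Probability/Percolation`; family `crit-perc`, statement **crit-perc.S16**, the
mean-cluster-size exponent `γ = 43/18`
(`Literature.Probability.Percolation.triMeanClusterSize_exponent`, `ArmExponents.lean`: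
S. Smirnov, W. Werner, *Math. Res. Lett.* 8 (2001), Thm. 1 (ii); H. Kesten, *Comm. Math. Phys.*
109 (1987), scaling relation for `χ`; P. Nolin, *Electron. J. Probab.* 13 (2008), §7.5).
PROOFS ONLY (no new definition, no new named fact): the state of the reduction of
`triMeanClusterSize_exponent` after the tree

* derived Kesten's relation `Nolin2008_prop34` (`Nolin2008_prop34_of_facts`,
  `KestenScalingFromFourFacts.lean`) and the near-critical one-arm stability on both sides of
  `1/2`, `Nolin2008_thm27_oneArm` (`Nolin2008_thm27_oneArm_of_facts4`,
  `NearCriticalOneArmFromFourFacts.lean`), from the four named facts of Kesten's near-critical arm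
  calculus in W. Werner's form (*Lectures on two-dimensional critical percolation*, PCMI 2009,
  Lecture 6): `Werner2009_fourArm_quasiMult` (Cor. 6.2), `Werner2009_fourArm_lowerBound` (§3,
  third a priori estimate), `Werner2009_halfPlane_twoArm` (§3 ¶1) and
  `Werner2009_pivotal_lowerBound` (proof of Lemma 6.2, lower bound);
* proved the near-critical mixed-colour half-plane two-arm estimate
  `Werner2009_halfPlane_twoArm_holds` (`HalfPlaneTwoArmRadiiNearCritical.lean`).

With `triMeanClusterSize_exponent_of_leaves4` (`MeanClusterSizeExponentFromFacts.lean`: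
`oneArm_exponent → fourArm_exponent → Nolin2008_prop34 → Nolin2008_thm27_oneArm →
triMeanClusterSize_exponent`, Nolin's §7.5 with the exponential decay above `L_ε` proved in the
tree) this gives:

* `triMeanClusterSize_exponent_of_facts4` — `γ = 43/18` from `oneArm_exponent`, `fourArm_exponent`
  and the four Werner facts;
* `triMeanClusterSize_exponent_of_facts3` — **`γ = 43/18` from exactly five named facts of the
  tree**: the two critical arm exponents `oneArm_exponent` (`5/48`, Lawler–Schramm–Werner 2002),
  `fourArm_exponent` (`5/4`, Smirnov–Werner 2001) and the three near-critical inputs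
  `Werner2009_fourArm_quasiMult`, `Werner2009_fourArm_lowerBound`,
  `Werner2009_pivotal_lowerBound`; everything else of Kesten 1987 / Nolin 2008 §7 / Werner 2009
  Lecture 6 used on the way (Russo's formula, pivotal geometry, the differential inequalities,
  RSW below `L_ε` on both sides of `1/2`, circuits and gluing, the sub-critical exponential decay,
  the two-point estimates and the summations of §7.5) being proved in the tree.

The discharge `triMeanClusterSize_exponent_holds` is `triMeanClusterSize_exponent_of_facts3`
applied to `oneArm_exponent_holds`, `fourArm_exponent_holds`, `Werner2009_fourArm_quasiMult_holds`,
`Werner2009_fourArm_lowerBound_holds`, `Werner2009_pivotal_lowerBound_holds` once these land (none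
is in the tree yet); these are the same five leaves on which `triTheta_exponent` (`β = 5/36`,
`triTheta_exponent_of_facts6` with `Werner2009_lemma63_of_facts`) now rests.

## References

* S. Smirnov, W. Werner, Critical exponents for two-dimensional percolation, *Math. Res. Lett.*
  8 (2001) 729–744, §2, Thm. 1 (ii) (arXiv:math/0109120) [SmirnovWernerMRL2001].
* H. Kesten, Scaling relations for 2D-percolation, *Comm. Math. Phys.* 109 (1987) 109–156,
  Thm. 2, (4.5) and the scaling relation for `χ` [KestenScalingCMP1987].
* P. Nolin, Near-critical percolation in two dimensions, *Electron. J. Probab.* 13 (2008)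
  1562–1623, §6.1 Thm. 27, §7.3 Prop. 34, §7.5 (arXiv 0711.4948: Thm. 26, Prop. 32, §7.5
  Prop. 43) [Nolin2008].
* W. Werner, *Lectures on two-dimensional critical percolation*, IAS/Park City Math. Ser. 16
  (2009), Lecture 6, §3, Cor. 6.2, Lemma 6.2, Lemma 6.3, §5 [WernerPCMI2009].

Tree: `triMeanClusterSize_exponent_of_leaves4` (`MeanClusterSizeExponentFromFacts.lean`),
`Nolin2008_prop34_of_facts` (`KestenScalingFromFourFacts.lean`),
`Nolin2008_thm27_oneArm_of_facts4` (`NearCriticalOneArmFromFourFacts.lean`),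
`Werner2009_halfPlane_twoArm_holds` (`HalfPlaneTwoArmRadiiNearCritical.lean`), the named facts
(`ArmExponents.lean`, `NearCriticalFourArmFacts.lean`, `NearCriticalBoundaryFacts.lean`).
Mathlib: nothing beyond the imports of these files.
-/

noncomputable section

namespace Literature.Probability.Percolation

/-- **`γ = 43/18` (Smirnov–Werner 2001, Thm. 1 (ii)) from the two arm exponents and the four named
facts of the near-critical arm calculus**: `oneArm_exponent`, `fourArm_exponent`,
`Werner2009_fourArm_quasiMult` (Werner 2009, Cor. 6.2), `Werner2009_fourArm_lowerBound` (§3),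
`Werner2009_halfPlane_twoArm` (§3 ¶1) and `Werner2009_pivotal_lowerBound` (proof of Lemma 6.2)
imply `triMeanClusterSize_exponent` — `triMeanClusterSize_exponent_of_leaves4` with Kesten's
relation from `Nolin2008_prop34_of_facts` and the one-arm stability (Nolin 2008, Thm. 27, `j = 1`,
both sides of `1/2`) from `Nolin2008_thm27_oneArm_of_facts4`. [cite: SmirnovWernerMRL2001, §2, Thm. 1 (ii) (arXiv:math/0109120)] [cite: KestenScalingCMP1987, Thm. 2, (4.5) and the scaling relation for χ] [cite: Nolin2008, §6.1 Thm. 27, §7.3 Prop. 34 (EJP numbering; arXiv 0711.4948: Thm. 26, Prop. 32); §7.5 Prop. 43 (arXiv numbering)] [cite: WernerPCMI2009, Lecture 6, §3, Cor. 6.2, Lemma 6.2, Lemma 6.3, §5] -/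
theorem triMeanClusterSize_exponent_of_facts4 (h₁ : oneArm_exponent) (h₄ : fourArm_exponent)
    (hQM : Werner2009_fourArm_quasiMult) (hLB : Werner2009_fourArm_lowerBound)
    (hHPW : Werner2009_halfPlane_twoArm) (hP : Werner2009_pivotal_lowerBound) :
    triMeanClusterSize_exponent :=
  triMeanClusterSize_exponent_of_leaves4 h₁ h₄ (Nolin2008_prop34_of_facts hQM hLB hHPW hP)
    (Nolin2008_thm27_oneArm_of_facts4 hQM hLB hHPW hP)

/-- **`γ = 43/18` (Smirnov–Werner 2001, Thm. 1 (ii)) from five named facts of the tree**: the two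
critical arm exponents `oneArm_exponent`, `fourArm_exponent` and the three near-critical inputs
`Werner2009_fourArm_quasiMult` (Werner 2009, Cor. 6.2), `Werner2009_fourArm_lowerBound` (§3, third
a priori estimate), `Werner2009_pivotal_lowerBound` (proof of Lemma 6.2, lower bound) —
`triMeanClusterSize_exponent_of_facts4` with the near-critical half-plane two-arm estimate supplied
by the tree's theorem `Werner2009_halfPlane_twoArm_holds`. The discharge
`triMeanClusterSize_exponent_holds` is this theorem applied to the five `_holds` once they land. [cite: SmirnovWernerMRL2001, §2, Thm. 1 (ii) (arXiv:math/0109120)] [cite: KestenScalingCMP1987, Thm. 2, (4.5) and the scaling relation for χ] [cite: Nolin2008, §7.5 Prop. 43 (arXiv 0711.4948 numbering)] [cite: WernerPCMI2009, Lecture 6, §3, Cor. 6.2, Lemma 6.2, §5] -/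
theorem triMeanClusterSize_exponent_of_facts3 (h₁ : oneArm_exponent) (h₄ : fourArm_exponent)
    (hQM : Werner2009_fourArm_quasiMult) (hLB : Werner2009_fourArm_lowerBound)
    (hP : Werner2009_pivotal_lowerBound) : triMeanClusterSize_exponent :=
  triMeanClusterSize_exponent_of_facts4 h₁ h₄ hQM hLB Werner2009_halfPlane_twoArm_holds hP

end Literature.Probability.Percolation
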